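import Summits.RiemannHypothesis.RiemannHypothesis.Theorems.SemilocalDeletionPairCeiling
import Summits.RiemannHypothesis.RiemannHypothesis.Theorems.SemilocalDeletionPairInteraction
import HarnessLib

/-!
# The PAIR HALF-ROOM LAW: `λ_min(S∖{p₁,p₂}; (log p₂)/2 + δ; σ) ∈ [−ρ₄, −ρ₄ + 4·λ_min(S; δ; σ̄)]`, and the pair interaction is the Perron defect

Capstone of the two-prime deletion files.  `SemilocalDeletionPairFloor` (floor `−ρ₄`, `ρ₄ = (w₂ + √(w₂² + 4w₁²))/2` the Perron
root of the 4-path orbit graph of two SPREAD lags), `SemilocalDeletionPairCeiling` (the signed Perron 4-path comb attains `−ρ₄` up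
to the undeleted form's energy on the comb) and `SemilocalDeletionDipoleHalfRoom` (parallelogram law: a dipole costs at most four
blocks) combine, at the natural window `c = (log p₂)/2 + δ` of the larger prime (where the Perron comb is CENTRED, hence has a
parity), into the two-prime analogue of the single-prime half-room law:

* §1–§2 the centred comb is `−(d_{L₂} + θ·d_{2L₁−L₂})` (two antisymmetric dipoles of the block `h ∈ C(δ)`), so under positivity
  of `Q_S` on `C((log p₂)/2 + δ)` its energy is at most `(8 + 8θ²)·Re Q_S(h)` while its norm is `(2 + 2θ²)‖h‖₂²`
  (`re_weilSemilocalQuadratic_pairComb_le`); `h` even ⇒ comb odd, `h` odd ⇒ comb even;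
* §3 **the pair half-room law** (`p₁ ≠ p₂` primes in `S`, `0 < δ`, `2δ < log p₂ − log p₁`, `2δ < 2 log p₁ − log p₂`,
  `Q_S ≥ 0` on `C((log p₂)/2 + δ)`; the two `δ`-conditions ARE the spread and single-visibility conditions at this window):
  `λ_min(S∖{p₁,p₂}; (log p₂)/2 + δ; odd) ∈ [−ρ₄, −ρ₄ + 4·λ_min(S; δ; even)]`, the same with even/odd exchanged, and the
  all-sector version;
* §4 **the pair interaction is the Perron defect up to window energies**: with `SemilocalDeletionPairInteraction` (lower bound)
  the Möbius pair term `I_σ = λ(S∖{p₁,p₂}) − λ(S∖{p₁}) − λ(S∖{p₂}) + λ(S)` at this window satisfies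
  `(w₁ + w₂ − ρ₄) − 2λ_min(S; δ + (log p₂ − log p₁)/2; σ̄) − 2λ_min(S; δ; σ̄) ≤ I_σ ≤ (w₁ + w₂ − ρ₄) + 4λ_min(S; δ; σ̄)`.

Certified numerics (rh-explicit, lineage E, N = 200, free odd, BLIND cells of PRED-CLIFF19-ORBIT PART O; `9/5 = (log 23)/2 + δ`,
`δ = 0.2323`, `ε_ev(δ) ≤ ε_ev,200(0.2259) = 0.0573`): `U∖{11,23}` bottom `−1.11254 ∈ [−1.12033, −0.891]`, `U∖{13,23}` `−1.10378 ∈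
[−1.10980, −0.881]`; interaction `I({11,23}) = +0.26270 ∈ [0.1418, 0.4856]`.  Nothing here bears on RH.
-/

set_option linter.dupNamespace false

noncomputable section

open Complex Filter Set MeasureTheory
open scoped Real Topology ComplexConjugate

namespace Summit.RiemannHypothesis.RiemannHypothesis.Theorems.SemilocalDeletionPairHalfRoom

open Literature.NumberTheory.LFunctions
open Summit.RiemannHypothesis.RiemannHypothesis.Theorems.SemilocalDeletionCliff
open Summit.RiemannHypothesis.RiemannHypothesis.Theorems.SemilocalDeletionDipole
open Summit.RiemannHypothesis.RiemannHypothesis.Theorems.SemilocalDeletionDipoleHalfRoom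
open Summit.RiemannHypothesis.RiemannHypothesis.Theorems.SemilocalDeletionPairFloor
open Summit.RiemannHypothesis.RiemannHypothesis.Theorems.SemilocalDeletionPairCeiling
open Summit.RiemannHypothesis.RiemannHypothesis.Theorems.SemilocalDeletionPairInteraction
open Summit.RiemannHypothesis.RiemannHypothesis.Theorems.HandoffSemilocalEnergy

variable {g u v h : ℝ → ℂ} {δ L₁ L₂ θ : ℝ} {S : Finset ℕ}

/-! ## §1  Parallelogram law under positivity: `Re Q_S(u + v) ≤ 2 Re Q_S(u) + 2 Re Q_S(v)` -/
/-- If `Re Q_S(u − v) ≥ 0` then `Re Q_S(u + v) ≤ 2·Re Q_S(u) + 2·Re Q_S(v)` (parallelogram law). -/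
theorem re_weilSemilocalQuadratic_add_le (S : Finset ℕ) (hu : IsWeilTest u) (hv : IsWeilTest v)
    (h0 : 0 ≤ (weilSemilocalQuadratic S (u - v)).re) :
    (weilSemilocalQuadratic S (u + v)).re ≤
      2 * (weilSemilocalQuadratic S u).re + 2 * (weilSemilocalQuadratic S v).re := by
  have hpar := congrArg Complex.re (weilSemilocalQuadratic_parallelogram S hu hv)
  rw [Complex.add_re, Complex.add_re] at hpar
  have e1 : ((2 : ℂ) * weilSemilocalQuadratic S u).re = 2 * (weilSemilocalQuadratic S u).re := by simp [Complex.mul_re]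
  have e2 : ((2 : ℂ) * weilSemilocalQuadratic S v).re = 2 * (weilSemilocalQuadratic S v).re := by simp [Complex.mul_re]
  rw [e1, e2] at hpar
  linarith

/-- `Re Q_S(θ·g) = θ²·Re Q_S(g)` for real `θ`. -/
theorem re_weilSemilocalQuadratic_real_mul (S : Finset ℕ) (θ : ℝ) (g : ℝ → ℂ) :
    (weilSemilocalQuadratic S (fun t ↦ (θ : ℂ) * g t)).re = θ ^ 2 * (weilSemilocalQuadratic S g).re := by
  rw [weilSemilocalQuadratic_const_mul, Complex.normSq_ofReal, Complex.re_ofReal_mul]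
  ring

/-! ## §2  The centred Perron comb is a pair of dipoles -/

/-- At the window `c = L₂/2 + δ` the signed 4-path comb of `SemilocalDeletionPairCeiling` (nodes `−c+δ, −c+δ+(L₂−L₁), −c+δ+L₁,
−c+δ+L₂`, signs `−1, −θ, θ, 1`) is CENTRED and equals `−(d_{L₂} + θ·d_{2L₁−L₂})`, `d_L(t) = h(t + L/2) − h(t − L/2)`. -/
theorem pairComb_apply (h : ℝ → ℂ) (L₁ L₂ δ θ t : ℝ) :
    (∑ i ∈ Finset.range 4, (([-1, -θ, θ, 1].getD i (0 : ℝ) : ℝ) : ℂ) *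
        h (t - [-(L₂ / 2 + δ) + δ, -(L₂ / 2 + δ) + δ + (L₂ - L₁), -(L₂ / 2 + δ) + δ + L₁, -(L₂ / 2 + δ) + δ + L₂].getD i 0)) =
      -((h (t + L₂ / 2) - h (t - L₂ / 2)) + (θ : ℂ) * (h (t + (2 * L₁ - L₂) / 2) - h (t - (2 * L₁ - L₂) / 2))) := by
  have e0 : t - (-(L₂ / 2 + δ) + δ) = t + L₂ / 2 := by ring
  have e1 : t - (-(L₂ / 2 + δ) + δ + (L₂ - L₁)) = t + (2 * L₁ - L₂) / 2 := by ring
  have e2 : t - (-(L₂ / 2 + δ) + δ + L₁) = t - (2 * L₁ - L₂) / 2 := by ring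
  have e3 : t - (-(L₂ / 2 + δ) + δ + L₂) = t - L₂ / 2 := by ring
  simp only [Finset.sum_range_succ, Finset.sum_range_zero, zero_add, List.getD_cons_zero, List.getD_cons_succ]
  rw [e0, e1, e2, e3]
  push_cast
  ring

/-- PARITY of the centred comb: `h` even ⇒ comb odd. -/
theorem pairComb_odd_of_even (heven : ∀ t, h (-t) = h t) (L₁ L₂ δ θ t : ℝ) :
    (∑ i ∈ Finset.range 4, (([-1, -θ, θ, 1].getD i (0 : ℝ) : ℝ) : ℂ) *
        h (-t - [-(L₂ / 2 + δ) + δ, -(L₂ / 2 + δ) + δ + (L₂ - L₁), -(L₂ / 2 + δ) + δ + L₁, -(L₂ / 2 + δ) + δ + L₂].getD i 0)) =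
      -(∑ i ∈ Finset.range 4, (([-1, -θ, θ, 1].getD i (0 : ℝ) : ℝ) : ℂ) *
        h (t - [-(L₂ / 2 + δ) + δ, -(L₂ / 2 + δ) + δ + (L₂ - L₁), -(L₂ / 2 + δ) + δ + L₁, -(L₂ / 2 + δ) + δ + L₂].getD i 0)) := by
  rw [pairComb_apply, pairComb_apply, dipole_odd_of_even heven, dipole_odd_of_even heven]
  ring

/-- PARITY of the centred comb: `h` odd ⇒ comb even. -/
theorem pairComb_even_of_odd (hodd : ∀ t, h (-t) = -h t) (L₁ L₂ δ θ t : ℝ) :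
    (∑ i ∈ Finset.range 4, (([-1, -θ, θ, 1].getD i (0 : ℝ) : ℝ) : ℂ) *
        h (-t - [-(L₂ / 2 + δ) + δ, -(L₂ / 2 + δ) + δ + (L₂ - L₁), -(L₂ / 2 + δ) + δ + L₁, -(L₂ / 2 + δ) + δ + L₂].getD i 0)) =
      ∑ i ∈ Finset.range 4, (([-1, -θ, θ, 1].getD i (0 : ℝ) : ℝ) : ℂ) *
        h (t - [-(L₂ / 2 + δ) + δ, -(L₂ / 2 + δ) + δ + (L₂ - L₁), -(L₂ / 2 + δ) + δ + L₁, -(L₂ / 2 + δ) + δ + L₂].getD i 0) := by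
  rw [pairComb_apply, pairComb_apply, dipole_even_of_odd hodd, dipole_even_of_odd hodd]

/-- **Energy of the centred comb.** For a block `h ∈ C(δ)`, `0 ≤ 2L₁ − L₂ ≤ L₂`, and `Q_S ≥ 0` on `C(L₂/2 + δ)`:
`Re Q_S(comb) ≤ (8 + 8θ²)·Re Q_S(h)` — parallelogram law with the two dipoles (each costing at most `4·Re Q_S(h)` by
`re_weilSemilocalQuadratic_dipole_le`). -/
theorem re_weilSemilocalQuadratic_pairComb_le (hh : IsWeilTest h) (hsupp : tsupport h ⊆ Icc (-δ) δ)
    (hL : 0 ≤ 2 * L₁ - L₂) (hL' : 2 * L₁ - L₂ ≤ L₂) (hpos : WeilSemilocalPositivityOn S (L₂ / 2 + δ)) :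
    (weilSemilocalQuadratic S (fun t ↦ ∑ i ∈ Finset.range 4, (([-1, -θ, θ, 1].getD i (0 : ℝ) : ℝ) : ℂ) *
        h (t - [-(L₂ / 2 + δ) + δ, -(L₂ / 2 + δ) + δ + (L₂ - L₁), -(L₂ / 2 + δ) + δ + L₁,
          -(L₂ / 2 + δ) + δ + L₂].getD i 0))).re ≤
      (8 + 8 * θ ^ 2) * (weilSemilocalQuadratic S h).re := by
  set d₂ : ℝ → ℂ := fun t ↦ h (t + L₂ / 2) - h (t - L₂ / 2) with hd₂
  set d₁ : ℝ → ℂ := fun t ↦ h (t + (2 * L₁ - L₂) / 2) - h (t - (2 * L₁ - L₂) / 2) with hd₁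
  have hfun : (fun t ↦ ∑ i ∈ Finset.range 4, (([-1, -θ, θ, 1].getD i (0 : ℝ) : ℝ) : ℂ) *
      h (t - [-(L₂ / 2 + δ) + δ, -(L₂ / 2 + δ) + δ + (L₂ - L₁), -(L₂ / 2 + δ) + δ + L₁,
        -(L₂ / 2 + δ) + δ + L₂].getD i 0)) = -(d₂ + fun t ↦ (θ : ℂ) * d₁ t) := by
    funext t
    rw [pairComb_apply]
    simp only [hd₂, hd₁, Pi.neg_apply, Pi.add_apply]
  have hd₂T : IsWeilTest d₂ := isWeilTest_dipole hh L₂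
  have hd₁T : IsWeilTest d₁ := isWeilTest_dipole hh (2 * L₁ - L₂)
  have hθd₁T : IsWeilTest fun t ↦ (θ : ℂ) * d₁ t := hd₁T.const_mul _
  have hL₂ : 0 ≤ L₂ := hL.trans hL'
  -- supports
  have hs₂ : tsupport d₂ ⊆ Icc (-(L₂ / 2 + δ)) (L₂ / 2 + δ) := tsupport_dipole_subset hsupp hL₂
  have hs₁ : tsupport (fun t ↦ (θ : ℂ) * d₁ t) ⊆ Icc (-(L₂ / 2 + δ)) (L₂ / 2 + δ) :=
    (tsupport_mul_subset_right (f := fun _ : ℝ ↦ (θ : ℂ)) (g := d₁)).trans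
      ((tsupport_dipole_subset hsupp hL).trans (Icc_subset_Icc (by linarith) (by linarith)))
  -- positivity of the difference
  have h0 : 0 ≤ (weilSemilocalQuadratic S (d₂ - fun t ↦ (θ : ℂ) * d₁ t)).re := by
    refine hpos _ ⟨hd₂T.1.sub hθd₁T.1, hd₂T.2.sub hθd₁T.2⟩ ?_
    have : (d₂ - fun t ↦ (θ : ℂ) * d₁ t) = fun t ↦ d₂ t - (θ : ℂ) * d₁ t := rfl
    rw [this]
    exact (tsupport_sub d₂ fun t ↦ (θ : ℂ) * d₁ t).trans (union_subset hs₂ hs₁)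
  have hpar := re_weilSemilocalQuadratic_add_le S hd₂T hθd₁T h0
  -- the two dipole bounds
  have hD₂ := re_weilSemilocalQuadratic_dipole_le (S := S) hh hsupp hL₂ hpos
  have hD₁ := re_weilSemilocalQuadratic_dipole_le (S := S) hh hsupp hL (hpos.mono (by linarith))
  have hθ := re_weilSemilocalQuadratic_real_mul S θ d₁
  rw [hfun, weilSemilocalQuadratic_neg]
  rw [hθ] at hpar
  have hQ : 0 ≤ (weilSemilocalQuadratic S h).re := hpos h hh (hsupp.trans (Icc_subset_Icc (by linarith) (by linarith)))
  nlinarith [sq_nonneg θ]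

/-- The squared weights of the comb: `Σ b_i² = 2 + 2θ²`. -/
theorem sum_sq_weights (θ : ℝ) : ∑ i ∈ Finset.range 4, ([-1, -θ, θ, 1].getD i (0 : ℝ)) ^ 2 = 2 + 2 * θ ^ 2 := by
  simp only [Finset.sum_range_succ, Finset.sum_range_zero, zero_add, List.getD_cons_zero, List.getD_cons_succ]
  ring

/-! ## §3  The pair half-room law at the window `(log p₂)/2 + δ` -/

variable {p₁ p₂ : ℕ} {P : (ℝ → ℂ) → Prop}

/-- **Comb test under positivity.** `p₁ ≠ p₂` primes in `S`, `0 ≤ δ`, `2δ < log p₂ − log p₁`, `2δ < 2 log p₁ − log p₂`, `Q_S ≥ 0`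
on `C((log p₂)/2 + δ)`; `P` a constraint containing the centred comb of the block `h ∈ C(δ)` and its positive multiples.  Then
`(λ_min(S∖{p₁,p₂}; (log p₂)/2 + δ; P) + ρ₄)·‖h‖₂² ≤ 4·Re Q_S(h)`. -/
theorem semilocalGroundEnergy_sdiff_pair_add_mul_le_four_mul (hh : IsWeilTest h) (hsupp : tsupport h ⊆ Icc (-δ) δ)
    (hδ : 0 ≤ δ) (hp₁ : p₁.Prime) (hp₂ : p₂.Prime) (h1S : p₁ ∈ S) (h2S : p₂ ∈ S) (hne : p₁ ≠ p₂)
    (hd : 2 * δ < Real.log p₂ - Real.log p₁) (hd' : 2 * δ < 2 * Real.log p₁ - Real.log p₂)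
    (hpos : WeilSemilocalPositivityOn S (Real.log p₂ / 2 + δ))
    (hP : ∀ r : ℝ, 0 < r → P fun t ↦ (r : ℂ) * ∑ i ∈ Finset.range 4,
        (([-1, -((Real.log p₁ / Real.sqrt p₁) /
              ((Real.log p₂ / Real.sqrt p₂ + Real.sqrt ((Real.log p₂ / Real.sqrt p₂) ^ 2 + 4 * (Real.log p₁ / Real.sqrt p₁) ^ 2)) / 2)),
            (Real.log p₁ / Real.sqrt p₁) /
              ((Real.log p₂ / Real.sqrt p₂ + Real.sqrt ((Real.log p₂ / Real.sqrt p₂) ^ 2 + 4 * (Real.log p₁ / Real.sqrt p₁) ^ 2)) / 2),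
            1].getD i (0 : ℝ) : ℝ) : ℂ) *
          h (t - [-(Real.log p₂ / 2 + δ) + δ, -(Real.log p₂ / 2 + δ) + δ + (Real.log p₂ - Real.log p₁),
            -(Real.log p₂ / 2 + δ) + δ + Real.log p₁, -(Real.log p₂ / 2 + δ) + δ + Real.log p₂].getD i 0)) :
    (semilocalGroundEnergy (S \ {p₁, p₂}) P (Real.log p₂ / 2 + δ) +
        (Real.log p₂ / Real.sqrt p₂ + Real.sqrt ((Real.log p₂ / Real.sqrt p₂) ^ 2 + 4 * (Real.log p₁ / Real.sqrt p₁) ^ 2)) / 2) *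
      ∫ u : ℝ, ‖h u‖ ^ 2 ≤ 4 * (weilSemilocalQuadratic S h).re := by
  set θ : ℝ := (Real.log p₁ / Real.sqrt p₁) /
      ((Real.log p₂ / Real.sqrt p₂ + Real.sqrt ((Real.log p₂ / Real.sqrt p₂) ^ 2 + 4 * (Real.log p₁ / Real.sqrt p₁) ^ 2)) / 2)
    with hθ
  have hc1 : Real.log p₂ / 2 + δ < Real.log p₁ := by linarith
  have hfit : Real.log p₂ + 2 * δ ≤ 2 * (Real.log p₂ / 2 + δ) := by linarith
  have hJ := semilocalGroundEnergy_sdiff_pair_add_mul_le_of_constraint (P := P) (c := Real.log p₂ / 2 + δ) hh hsupp hδ hp₁ hp₂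
    h1S h2S hne hc1 hd hd' hfit hP
  have hE := re_weilSemilocalQuadratic_pairComb_le (S := S) (θ := θ) (L₁ := Real.log p₁) (L₂ := Real.log p₂) hh hsupp
    (by linarith) (by linarith) hpos
  rw [sum_sq_weights θ] at hJ
  have hN : 0 ≤ ∫ u : ℝ, ‖h u‖ ^ 2 := integral_nonneg fun _ ↦ by positivity
  have h22 : (0 : ℝ) < 2 + 2 * θ ^ 2 := by positivity
  -- (λ + ρ)·(2+2θ²)·N ≤ (8+8θ²)·Q  ⇒  (λ + ρ)·N ≤ 4Q
  have key : (2 + 2 * θ ^ 2) * ((semilocalGroundEnergy (S \ {p₁, p₂}) P (Real.log p₂ / 2 + δ) +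
      (Real.log p₂ / Real.sqrt p₂ + Real.sqrt ((Real.log p₂ / Real.sqrt p₂) ^ 2 + 4 * (Real.log p₁ / Real.sqrt p₁) ^ 2)) / 2) *
        ∫ u : ℝ, ‖h u‖ ^ 2) ≤ (2 + 2 * θ ^ 2) * (4 * (weilSemilocalQuadratic S h).re) := by
    calc (2 + 2 * θ ^ 2) * ((semilocalGroundEnergy (S \ {p₁, p₂}) P (Real.log p₂ / 2 + δ) +
      (Real.log p₂ / Real.sqrt p₂ + Real.sqrt ((Real.log p₂ / Real.sqrt p₂) ^ 2 + 4 * (Real.log p₁ / Real.sqrt p₁) ^ 2)) / 2) *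
        ∫ u : ℝ, ‖h u‖ ^ 2)
        = (semilocalGroundEnergy (S \ {p₁, p₂}) P (Real.log p₂ / 2 + δ) +
      (Real.log p₂ / Real.sqrt p₂ + Real.sqrt ((Real.log p₂ / Real.sqrt p₂) ^ 2 + 4 * (Real.log p₁ / Real.sqrt p₁) ^ 2)) / 2) *
        ((2 + 2 * θ ^ 2) * ∫ u : ℝ, ‖h u‖ ^ 2) := by ring
      _ ≤ _ := hJ
      _ ≤ (8 + 8 * θ ^ 2) * (weilSemilocalQuadratic S h).re := hE
      _ = (2 + 2 * θ ^ 2) * (4 * (weilSemilocalQuadratic S h).re) := by ring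
  exact le_of_mul_le_mul_left key h22

/-- **THE PAIR HALF-ROOM LAW, odd sector ← even blocks.** `p₁ ≠ p₂` primes in `S`, `0 < δ`, `2δ < log p₂ − log p₁`,
`2δ < 2 log p₁ − log p₂`, `Q_S ≥ 0` on `C((log p₂)/2 + δ)`:
`λ_min(S∖{p₁,p₂}; (log p₂)/2 + δ; odd) ≤ −ρ₄ + 4·λ_min(S; δ; even)`. -/
theorem semilocalGroundEnergy_sdiff_pair_odd_le (hp₁ : p₁.Prime) (hp₂ : p₂.Prime) (h1S : p₁ ∈ S) (h2S : p₂ ∈ S)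
    (hne : p₁ ≠ p₂) (hδ0 : 0 < δ) (hd : 2 * δ < Real.log p₂ - Real.log p₁) (hd' : 2 * δ < 2 * Real.log p₁ - Real.log p₂)
    (hpos : WeilSemilocalPositivityOn S (Real.log p₂ / 2 + δ)) :
    semilocalGroundEnergy (S \ {p₁, p₂}) (fun g ↦ ∀ t, g (-t) = -g t) (Real.log p₂ / 2 + δ) ≤
      -((Real.log p₂ / Real.sqrt p₂ + Real.sqrt ((Real.log p₂ / Real.sqrt p₂) ^ 2 + 4 * (Real.log p₁ / Real.sqrt p₁) ^ 2)) / 2) +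
        4 * semilocalGroundEnergy S (fun g ↦ ∀ t, g (-t) = g t) δ := by
  have key : (semilocalGroundEnergy (S \ {p₁, p₂}) (fun g ↦ ∀ t, g (-t) = -g t) (Real.log p₂ / 2 + δ) +
      (Real.log p₂ / Real.sqrt p₂ + Real.sqrt ((Real.log p₂ / Real.sqrt p₂) ^ 2 + 4 * (Real.log p₁ / Real.sqrt p₁) ^ 2)) / 2) / 4 ≤
      semilocalGroundEnergy S (fun g ↦ ∀ t, g (-t) = g t) δ := by
    refine le_semilocalGroundEnergy (semilocalSphereValues_even_nonempty S hδ0) fun g hg hs hPg hn ↦ ?_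
    have := semilocalGroundEnergy_sdiff_pair_add_mul_le_four_mul (P := fun g ↦ ∀ t, g (-t) = -g t) hg hs hδ0.le hp₁ hp₂
      h1S h2S hne hd hd' hpos fun r _ t ↦ by
        show (r : ℂ) * _ = -((r : ℂ) * _)
        rw [pairComb_odd_of_even hPg]
        ring
    rw [hn, mul_one] at this
    linarith
  linarith

/-- **THE PAIR HALF-ROOM LAW, even sector ← odd blocks.**
`λ_min(S∖{p₁,p₂}; (log p₂)/2 + δ; even) ≤ −ρ₄ + 4·λ_min(S; δ; odd)`. -/
theorem semilocalGroundEnergy_sdiff_pair_even_le (hp₁ : p₁.Prime) (hp₂ : p₂.Prime) (h1S : p₁ ∈ S) (h2S : p₂ ∈ S)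
    (hne : p₁ ≠ p₂) (hδ0 : 0 < δ) (hd : 2 * δ < Real.log p₂ - Real.log p₁) (hd' : 2 * δ < 2 * Real.log p₁ - Real.log p₂)
    (hpos : WeilSemilocalPositivityOn S (Real.log p₂ / 2 + δ)) :
    semilocalGroundEnergy (S \ {p₁, p₂}) (fun g ↦ ∀ t, g (-t) = g t) (Real.log p₂ / 2 + δ) ≤
      -((Real.log p₂ / Real.sqrt p₂ + Real.sqrt ((Real.log p₂ / Real.sqrt p₂) ^ 2 + 4 * (Real.log p₁ / Real.sqrt p₁) ^ 2)) / 2) +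
        4 * semilocalGroundEnergy S (fun g ↦ ∀ t, g (-t) = -g t) δ := by
  have key : (semilocalGroundEnergy (S \ {p₁, p₂}) (fun g ↦ ∀ t, g (-t) = g t) (Real.log p₂ / 2 + δ) +
      (Real.log p₂ / Real.sqrt p₂ + Real.sqrt ((Real.log p₂ / Real.sqrt p₂) ^ 2 + 4 * (Real.log p₁ / Real.sqrt p₁) ^ 2)) / 2) / 4 ≤
      semilocalGroundEnergy S (fun g ↦ ∀ t, g (-t) = -g t) δ := by
    refine le_semilocalGroundEnergy (semilocalSphereValues_odd_nonempty S hδ0) fun g hg hs hPg hn ↦ ?_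
    have := semilocalGroundEnergy_sdiff_pair_add_mul_le_four_mul (P := fun g ↦ ∀ t, g (-t) = g t) hg hs hδ0.le hp₁ hp₂
      h1S h2S hne hd hd' hpos fun r _ t ↦ by
        show (r : ℂ) * _ = (r : ℂ) * _
        rw [pairComb_even_of_odd hPg]
    rw [hn, mul_one] at this
    linarith
  linarith

/-- **THE PAIR HALF-ROOM LAW, all sectors.** `λ_min(S∖{p₁,p₂}; (log p₂)/2 + δ) ≤ −ρ₄ + 4·λ_min(S; δ)`. -/
theorem semilocalGroundEnergy_sdiff_pair_top_le (hp₁ : p₁.Prime) (hp₂ : p₂.Prime) (h1S : p₁ ∈ S) (h2S : p₂ ∈ S)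
    (hne : p₁ ≠ p₂) (hδ0 : 0 < δ) (hd : 2 * δ < Real.log p₂ - Real.log p₁) (hd' : 2 * δ < 2 * Real.log p₁ - Real.log p₂)
    (hpos : WeilSemilocalPositivityOn S (Real.log p₂ / 2 + δ)) :
    semilocalGroundEnergy (S \ {p₁, p₂}) (fun _ ↦ True) (Real.log p₂ / 2 + δ) ≤
      -((Real.log p₂ / Real.sqrt p₂ + Real.sqrt ((Real.log p₂ / Real.sqrt p₂) ^ 2 + 4 * (Real.log p₁ / Real.sqrt p₁) ^ 2)) / 2) +
        4 * semilocalGroundEnergy S (fun _ ↦ True) δ := by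
  have key : (semilocalGroundEnergy (S \ {p₁, p₂}) (fun _ ↦ True) (Real.log p₂ / 2 + δ) +
      (Real.log p₂ / Real.sqrt p₂ + Real.sqrt ((Real.log p₂ / Real.sqrt p₂) ^ 2 + 4 * (Real.log p₁ / Real.sqrt p₁) ^ 2)) / 2) / 4 ≤
      semilocalGroundEnergy S (fun _ ↦ True) δ := by
    refine le_semilocalGroundEnergy (semilocalSphereValues_top_nonempty S hδ0) fun g hg hs _ hn ↦ ?_
    have := semilocalGroundEnergy_sdiff_pair_add_mul_le_four_mul (P := fun _ ↦ True) hg hs hδ0.le hp₁ hp₂ h1S h2S hne hd hd'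
      hpos fun _ _ ↦ trivial
    rw [hn, mul_one] at this
    linarith
  linarith

/-- Under positivity every (scaling-stable) constrained bottom of the doubly-deleted form sits ON OR ABOVE `−ρ₄`. -/
theorem neg_perron_le_semilocalGroundEnergy_sdiff_pair (hp₁ : p₁.Prime) (hp₂ : p₂.Prime) (h1S : p₁ ∈ S) (h2S : p₂ ∈ S)
    (hne : p₁ ≠ p₂) (hδ : 0 ≤ δ) (hd : 2 * δ < Real.log p₂ - Real.log p₁) (hd' : 2 * δ < 2 * Real.log p₁ - Real.log p₂)
    (hpos : WeilSemilocalPositivityOn S (Real.log p₂ / 2 + δ))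
    (hP : ∀ (a : ℝ) (g : ℝ → ℂ), 0 < a → P g → P fun t ↦ (a : ℂ) * g t) :
    -((Real.log p₂ / Real.sqrt p₂ + Real.sqrt ((Real.log p₂ / Real.sqrt p₂) ^ 2 + 4 * (Real.log p₁ / Real.sqrt p₁) ^ 2)) / 2) ≤
      semilocalGroundEnergy (S \ {p₁, p₂}) P (Real.log p₂ / 2 + δ) := by
  have hE := semilocalGroundEnergy_sdiff_pair_ge (P := P) (c := Real.log p₂ / 2 + δ) hp₁ hp₂ h1S h2S hne (by linarith)
    (by linarith) (by linarith)
  have h0 : 0 ≤ semilocalGroundEnergy S P (Real.log p₂ / 2 + δ) :=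
    (semilocalGroundEnergy_nonneg_iff hP).2 fun g hg hs _ ↦ hpos g hg hs
  linarith

/-- **THE PAIR SANDWICH, odd sector**: `λ_min(S∖{p₁,p₂}; (log p₂)/2 + δ; odd) ∈ [−ρ₄, −ρ₄ + 4·λ_min(S; δ; even)]`. -/
theorem semilocalGroundEnergy_sdiff_pair_odd_mem_Icc (hp₁ : p₁.Prime) (hp₂ : p₂.Prime) (h1S : p₁ ∈ S) (h2S : p₂ ∈ S)
    (hne : p₁ ≠ p₂) (hδ0 : 0 < δ) (hd : 2 * δ < Real.log p₂ - Real.log p₁) (hd' : 2 * δ < 2 * Real.log p₁ - Real.log p₂)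
    (hpos : WeilSemilocalPositivityOn S (Real.log p₂ / 2 + δ)) :
    semilocalGroundEnergy (S \ {p₁, p₂}) (fun g ↦ ∀ t, g (-t) = -g t) (Real.log p₂ / 2 + δ) ∈
      Icc (-((Real.log p₂ / Real.sqrt p₂ + Real.sqrt ((Real.log p₂ / Real.sqrt p₂) ^ 2 + 4 * (Real.log p₁ / Real.sqrt p₁) ^ 2)) / 2))
        (-((Real.log p₂ / Real.sqrt p₂ + Real.sqrt ((Real.log p₂ / Real.sqrt p₂) ^ 2 + 4 * (Real.log p₁ / Real.sqrt p₁) ^ 2)) / 2) +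
          4 * semilocalGroundEnergy S (fun g ↦ ∀ t, g (-t) = g t) δ) :=
  ⟨neg_perron_le_semilocalGroundEnergy_sdiff_pair hp₁ hp₂ h1S h2S hne hδ0.le hd hd' hpos
      (fun a g _ hg t ↦ by simp only [hg t, mul_neg]),
    semilocalGroundEnergy_sdiff_pair_odd_le hp₁ hp₂ h1S h2S hne hδ0 hd hd' hpos⟩

/-- **THE PAIR SANDWICH, even sector**: `λ_min(S∖{p₁,p₂}; (log p₂)/2 + δ; even) ∈ [−ρ₄, −ρ₄ + 4·λ_min(S; δ; odd)]`. -/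
theorem semilocalGroundEnergy_sdiff_pair_even_mem_Icc (hp₁ : p₁.Prime) (hp₂ : p₂.Prime) (h1S : p₁ ∈ S) (h2S : p₂ ∈ S)
    (hne : p₁ ≠ p₂) (hδ0 : 0 < δ) (hd : 2 * δ < Real.log p₂ - Real.log p₁) (hd' : 2 * δ < 2 * Real.log p₁ - Real.log p₂)
    (hpos : WeilSemilocalPositivityOn S (Real.log p₂ / 2 + δ)) :
    semilocalGroundEnergy (S \ {p₁, p₂}) (fun g ↦ ∀ t, g (-t) = g t) (Real.log p₂ / 2 + δ) ∈
      Icc (-((Real.log p₂ / Real.sqrt p₂ + Real.sqrt ((Real.log p₂ / Real.sqrt p₂) ^ 2 + 4 * (Real.log p₁ / Real.sqrt p₁) ^ 2)) / 2))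
        (-((Real.log p₂ / Real.sqrt p₂ + Real.sqrt ((Real.log p₂ / Real.sqrt p₂) ^ 2 + 4 * (Real.log p₁ / Real.sqrt p₁) ^ 2)) / 2) +
          4 * semilocalGroundEnergy S (fun g ↦ ∀ t, g (-t) = -g t) δ) :=
  ⟨neg_perron_le_semilocalGroundEnergy_sdiff_pair hp₁ hp₂ h1S h2S hne hδ0.le hd hd' hpos
      (fun a g _ hg t ↦ by simp only [hg t]),
    semilocalGroundEnergy_sdiff_pair_even_le hp₁ hp₂ h1S h2S hne hδ0 hd hd' hpos⟩

/-- **THE PAIR SANDWICH, all sectors**: `λ_min(S∖{p₁,p₂}; (log p₂)/2 + δ) ∈ [−ρ₄, −ρ₄ + 4·λ_min(S; δ)]`. -/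
theorem semilocalGroundEnergy_sdiff_pair_top_mem_Icc (hp₁ : p₁.Prime) (hp₂ : p₂.Prime) (h1S : p₁ ∈ S) (h2S : p₂ ∈ S)
    (hne : p₁ ≠ p₂) (hδ0 : 0 < δ) (hd : 2 * δ < Real.log p₂ - Real.log p₁) (hd' : 2 * δ < 2 * Real.log p₁ - Real.log p₂)
    (hpos : WeilSemilocalPositivityOn S (Real.log p₂ / 2 + δ)) :
    semilocalGroundEnergy (S \ {p₁, p₂}) (fun _ ↦ True) (Real.log p₂ / 2 + δ) ∈
      Icc (-((Real.log p₂ / Real.sqrt p₂ + Real.sqrt ((Real.log p₂ / Real.sqrt p₂) ^ 2 + 4 * (Real.log p₁ / Real.sqrt p₁) ^ 2)) / 2))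
        (-((Real.log p₂ / Real.sqrt p₂ + Real.sqrt ((Real.log p₂ / Real.sqrt p₂) ^ 2 + 4 * (Real.log p₁ / Real.sqrt p₁) ^ 2)) / 2) +
          4 * semilocalGroundEnergy S (fun _ ↦ True) δ) :=
  ⟨neg_perron_le_semilocalGroundEnergy_sdiff_pair hp₁ hp₂ h1S h2S hne hδ0.le hd hd' hpos (fun _ _ _ _ ↦ trivial),
    semilocalGroundEnergy_sdiff_pair_top_le hp₁ hp₂ h1S h2S hne hδ0 hd hd' hpos⟩

/-! ## §4  The pair interaction is the Perron defect `w₁ + w₂ − ρ₄` up to window energies -/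

/-- **PAIR INTERACTION, upper bound (odd sector)** at the window `(log p₂)/2 + δ` (hypotheses of the pair half-room law):
`λ(S∖{p₁,p₂}) − λ(S∖{p₁}) − λ(S∖{p₂}) + λ(S) ≤ (w₁ + w₂ − ρ₄) + 4·λ_min(S; δ; even)` (pair ceiling + the single-prime floors
`λ(S∖{pᵢ}) ≥ λ(S) − wᵢ` + `λ(S) ≥ 0`). -/
theorem pairInteraction_odd_le (hp₁ : p₁.Prime) (hp₂ : p₂.Prime) (h1S : p₁ ∈ S) (h2S : p₂ ∈ S) (hne : p₁ ≠ p₂)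
    (hδ0 : 0 < δ) (hd : 2 * δ < Real.log p₂ - Real.log p₁) (hd' : 2 * δ < 2 * Real.log p₁ - Real.log p₂)
    (hpos : WeilSemilocalPositivityOn S (Real.log p₂ / 2 + δ)) :
    semilocalGroundEnergy (S \ {p₁, p₂}) (fun g ↦ ∀ t, g (-t) = -g t) (Real.log p₂ / 2 + δ) -
      semilocalGroundEnergy (S.erase p₁) (fun g ↦ ∀ t, g (-t) = -g t) (Real.log p₂ / 2 + δ) -
      semilocalGroundEnergy (S.erase p₂) (fun g ↦ ∀ t, g (-t) = -g t) (Real.log p₂ / 2 + δ) +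
      semilocalGroundEnergy S (fun g ↦ ∀ t, g (-t) = -g t) (Real.log p₂ / 2 + δ) ≤
    (Real.log p₁ / Real.sqrt p₁ + Real.log p₂ / Real.sqrt p₂ -
        (Real.log p₂ / Real.sqrt p₂ + Real.sqrt ((Real.log p₂ / Real.sqrt p₂) ^ 2 + 4 * (Real.log p₁ / Real.sqrt p₁) ^ 2)) / 2) +
      4 * semilocalGroundEnergy S (fun g ↦ ∀ t, g (-t) = g t) δ := by
  have hU := semilocalGroundEnergy_sdiff_pair_odd_le hp₁ hp₂ h1S h2S hne hδ0 hd hd' hpos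
  have hF1 := semilocalGroundEnergy_erase_ge (S := S) (P := fun g ↦ ∀ t, g (-t) = -g t) (c := Real.log p₂ / 2 + δ) hp₁ h1S
    (by linarith)
  have hF2 := semilocalGroundEnergy_erase_ge (S := S) (P := fun g ↦ ∀ t, g (-t) = -g t) (c := Real.log p₂ / 2 + δ) hp₂ h2S
    (by linarith)
  have h0 : 0 ≤ semilocalGroundEnergy S (fun g ↦ ∀ t, g (-t) = -g t) (Real.log p₂ / 2 + δ) :=
    (semilocalGroundEnergy_nonneg_iff (S := S) (a := Real.log p₂ / 2 + δ) (P := fun g ↦ ∀ t, g (-t) = -g t)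
      (fun a g _ hg t ↦ by simp only [hg t, mul_neg])).2 fun g hg hs _ ↦ hpos g hg hs
  linarith

/-- **PAIR INTERACTION, upper bound (even sector)**: `I_even ≤ (w₁ + w₂ − ρ₄) + 4·λ_min(S; δ; odd)`. -/
theorem pairInteraction_even_le (hp₁ : p₁.Prime) (hp₂ : p₂.Prime) (h1S : p₁ ∈ S) (h2S : p₂ ∈ S) (hne : p₁ ≠ p₂)
    (hδ0 : 0 < δ) (hd : 2 * δ < Real.log p₂ - Real.log p₁) (hd' : 2 * δ < 2 * Real.log p₁ - Real.log p₂)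
    (hpos : WeilSemilocalPositivityOn S (Real.log p₂ / 2 + δ)) :
    semilocalGroundEnergy (S \ {p₁, p₂}) (fun g ↦ ∀ t, g (-t) = g t) (Real.log p₂ / 2 + δ) -
      semilocalGroundEnergy (S.erase p₁) (fun g ↦ ∀ t, g (-t) = g t) (Real.log p₂ / 2 + δ) -
      semilocalGroundEnergy (S.erase p₂) (fun g ↦ ∀ t, g (-t) = g t) (Real.log p₂ / 2 + δ) +
      semilocalGroundEnergy S (fun g ↦ ∀ t, g (-t) = g t) (Real.log p₂ / 2 + δ) ≤
    (Real.log p₁ / Real.sqrt p₁ + Real.log p₂ / Real.sqrt p₂ -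
        (Real.log p₂ / Real.sqrt p₂ + Real.sqrt ((Real.log p₂ / Real.sqrt p₂) ^ 2 + 4 * (Real.log p₁ / Real.sqrt p₁) ^ 2)) / 2) +
      4 * semilocalGroundEnergy S (fun g ↦ ∀ t, g (-t) = -g t) δ := by
  have hU := semilocalGroundEnergy_sdiff_pair_even_le hp₁ hp₂ h1S h2S hne hδ0 hd hd' hpos
  have hF1 := semilocalGroundEnergy_erase_ge (S := S) (P := fun g ↦ ∀ t, g (-t) = g t) (c := Real.log p₂ / 2 + δ) hp₁ h1S
    (by linarith)
  have hF2 := semilocalGroundEnergy_erase_ge (S := S) (P := fun g ↦ ∀ t, g (-t) = g t) (c := Real.log p₂ / 2 + δ) hp₂ h2S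
    (by linarith)
  have h0 : 0 ≤ semilocalGroundEnergy S (fun g ↦ ∀ t, g (-t) = g t) (Real.log p₂ / 2 + δ) :=
    (semilocalGroundEnergy_nonneg_iff (S := S) (a := Real.log p₂ / 2 + δ) (P := fun g ↦ ∀ t, g (-t) = g t)
      (fun a g _ hg t ↦ by simp only [hg t])).2 fun g hg hs _ ↦ hpos g hg hs
  linarith

/-- **PAIR INTERACTION, upper bound (all sectors)**: `I ≤ (w₁ + w₂ − ρ₄) + 4·λ_min(S; δ)`. -/
theorem pairInteraction_top_le (hp₁ : p₁.Prime) (hp₂ : p₂.Prime) (h1S : p₁ ∈ S) (h2S : p₂ ∈ S) (hne : p₁ ≠ p₂)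
    (hδ0 : 0 < δ) (hd : 2 * δ < Real.log p₂ - Real.log p₁) (hd' : 2 * δ < 2 * Real.log p₁ - Real.log p₂)
    (hpos : WeilSemilocalPositivityOn S (Real.log p₂ / 2 + δ)) :
    semilocalGroundEnergy (S \ {p₁, p₂}) (fun _ ↦ True) (Real.log p₂ / 2 + δ) -
      semilocalGroundEnergy (S.erase p₁) (fun _ ↦ True) (Real.log p₂ / 2 + δ) -
      semilocalGroundEnergy (S.erase p₂) (fun _ ↦ True) (Real.log p₂ / 2 + δ) +
      semilocalGroundEnergy S (fun _ ↦ True) (Real.log p₂ / 2 + δ) ≤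
    (Real.log p₁ / Real.sqrt p₁ + Real.log p₂ / Real.sqrt p₂ -
        (Real.log p₂ / Real.sqrt p₂ + Real.sqrt ((Real.log p₂ / Real.sqrt p₂) ^ 2 + 4 * (Real.log p₁ / Real.sqrt p₁) ^ 2)) / 2) +
      4 * semilocalGroundEnergy S (fun _ ↦ True) δ := by
  have hU := semilocalGroundEnergy_sdiff_pair_top_le hp₁ hp₂ h1S h2S hne hδ0 hd hd' hpos
  have hF1 := semilocalGroundEnergy_erase_ge (S := S) (P := fun _ ↦ True) (c := Real.log p₂ / 2 + δ) hp₁ h1S (by linarith)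
  have hF2 := semilocalGroundEnergy_erase_ge (S := S) (P := fun _ ↦ True) (c := Real.log p₂ / 2 + δ) hp₂ h2S (by linarith)
  have h0 : 0 ≤ semilocalGroundEnergy S (fun _ ↦ True) (Real.log p₂ / 2 + δ) :=
    (semilocalGroundEnergy_nonneg_iff (S := S) (a := Real.log p₂ / 2 + δ) (P := fun _ ↦ True)
      (fun _ _ _ _ ↦ trivial)).2 fun g hg hs _ ↦ hpos g hg hs
  linarith

/-- **TWO-SIDED PAIR INTERACTION (odd sector)**: at the window `(log p₂)/2 + δ`,
`(w₁ + w₂ − ρ₄) − 2λ_min(S; δ + (log p₂ − log p₁)/2; even) − 2λ_min(S; δ; even) ≤ I_odd ≤ (w₁ + w₂ − ρ₄) + 4λ_min(S; δ; even)`: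
the pair interaction IS the Perron defect of the orbit graph, up to even window energies at the half-rooms. -/
theorem pairInteraction_odd_mem_Icc (hp₁ : p₁.Prime) (hp₂ : p₂.Prime) (h1S : p₁ ∈ S) (h2S : p₂ ∈ S) (hne : p₁ ≠ p₂)
    (hδ0 : 0 < δ) (hd : 2 * δ < Real.log p₂ - Real.log p₁) (hd' : 2 * δ < 2 * Real.log p₁ - Real.log p₂)
    (hpos : WeilSemilocalPositivityOn S (Real.log p₂ / 2 + δ)) :
    semilocalGroundEnergy (S \ {p₁, p₂}) (fun g ↦ ∀ t, g (-t) = -g t) (Real.log p₂ / 2 + δ) -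
      semilocalGroundEnergy (S.erase p₁) (fun g ↦ ∀ t, g (-t) = -g t) (Real.log p₂ / 2 + δ) -
      semilocalGroundEnergy (S.erase p₂) (fun g ↦ ∀ t, g (-t) = -g t) (Real.log p₂ / 2 + δ) +
      semilocalGroundEnergy S (fun g ↦ ∀ t, g (-t) = -g t) (Real.log p₂ / 2 + δ) ∈
    Icc ((Real.log p₁ / Real.sqrt p₁ + Real.log p₂ / Real.sqrt p₂ -
          (Real.log p₂ / Real.sqrt p₂ + Real.sqrt ((Real.log p₂ / Real.sqrt p₂) ^ 2 + 4 * (Real.log p₁ / Real.sqrt p₁) ^ 2)) / 2) -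
        2 * semilocalGroundEnergy S (fun g ↦ ∀ t, g (-t) = g t) (δ + (Real.log p₂ - Real.log p₁) / 2) -
        2 * semilocalGroundEnergy S (fun g ↦ ∀ t, g (-t) = g t) δ)
      ((Real.log p₁ / Real.sqrt p₁ + Real.log p₂ / Real.sqrt p₂ -
          (Real.log p₂ / Real.sqrt p₂ + Real.sqrt ((Real.log p₂ / Real.sqrt p₂) ^ 2 + 4 * (Real.log p₁ / Real.sqrt p₁) ^ 2)) / 2) +
        4 * semilocalGroundEnergy S (fun g ↦ ∀ t, g (-t) = g t) δ) := by
  refine ⟨?_, pairInteraction_odd_le hp₁ hp₂ h1S h2S hne hδ0 hd hd' hpos⟩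
  have hL := pairInteraction_odd_ge (S := S) (c := Real.log p₂ / 2 + δ) hp₁ hp₂ h1S h2S hne (by linarith) (by linarith)
    (by linarith) (by linarith) hpos
  have e1 : Real.log p₂ / 2 + δ - Real.log p₁ / 2 = δ + (Real.log p₂ - Real.log p₁) / 2 := by ring
  have e2 : Real.log p₂ / 2 + δ - Real.log p₂ / 2 = δ := by ring
  rw [e1, e2] at hL
  exact hL

end Summit.RiemannHypothesis.RiemannHypothesis.Theorems.SemilocalDeletionPairHalfRoom

end
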